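import Summits.CriticalPhenomena.PercolationContinuityZ3.Theorems.Transplant.AutChartOrbitsOneLampNoGoAut
import Summits.CriticalPhenomena.PercolationContinuityZ3.Theorems.Transplant.GrigorchukLamplighterLabelRigidity
import Summits.CriticalPhenomena.PercolationContinuityZ3.Theorems.Transplant.GrigorchukTorsion
import Summits.CriticalPhenomena.PercolationContinuityZ3.Theorems.Transplant.FrmScaledTranslatingGroup
import Summits.CriticalPhenomena.PercolationContinuityZ3.Theorems.Transplant.AutChartOrbitsDatum
import Summits.CriticalPhenomena.PercolationContinuityZ3.Theorems.Transplant.PlanarSkeletonFrmDefs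
import Summits.CriticalPhenomena.PercolationContinuityZ3.Theorems.Transplant.PlanarSkeletonNegDefs
import Summits.CriticalPhenomena.PercolationContinuityZ3.Theorems.Transplant.PlanarSkeletonFrmFromDefs
import HarnessLib

/-!
# NO FRAMED SINGLE-STEP SKELETON ON BARTHOLDI–ERSCHLER'S CAYLEY GRAPH `Cay(ℤ ≀_X 𝔊; a, b, c, d, s)` — for ANY group of graph automorphisms
# (caveat (α) discharged for the single-step nodes U, U_s, N1, N2 and the orbit theorem (N3-a))

builds on p205010 (kernel theorem, internal audit signed; external expert review pending) — nothing in this file uses p205010.  This is a NEGATIVE (scope)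
record about the INPUTS of the lane's one-type / orbit nodes on ONE graph; no percolation statement; nothing about any `@[conjecture]` — in particular nothing
about `BenjaminiSchramm1996_conj4_endState` (MUST-NOT stands) — and `θ(p_c) = 0` on this graph stays NOT PROVED in the tree and not in print.  Lane
`prim-bschramm`, seat `prim-bschramm-p3` gen 36 (DESIGN OWNER; `P3-NILPOTENT.md` §29.4).  Helper file (`--supports stmt-CriticalPhenomena-4575 --as helper`).

CONTENT.
* §1 `Grigorchuk.frameW : OneLampFrame ↥wreathZ` — `Γ₂ = ℤ ≀_X 𝔊` IS a one-lamp frame: lamps `L = ker(tree projection)`, tree part `H ≅ 𝔊` TORSION by the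
  kernel theorem `Grigorchuk.isOfFinOrder_of_mem` (p591617), `s = sW` of infinite order (lamp sum), positions `h s h⁻¹ = lamp (g ρ) 1` pairwise independent
  (`Finsupp.single`), and `L` generated by the positions (closure induction over the five generators).
* §2 `Grigorchuk.labelAction_of_isActionByAut` — EVERY group acting on `Γ₂` by automorphisms of `Cay` is a `LabelAction` (label rigidity
  «GrigorchukLamplighterLabelRigidity» `cay_label_rigid`, extended from the letters `a, b, c, d` to the whole tree subgroup by closure induction).
* §3 THE CUSTOMERS: `cay_no_single_edge_steps` (for every group acting by automorphisms with finitely many orbits and every equivariant chart, the exact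
  single-edge steps `± N eᵢ` fail somewhere — «AutChartOrbitsOneLampNoGoAut» `no_single_edge_steps`); `cay_no_framed_steps` (the same for every chart with
  FRAMES, via the translating subgroup of «FrmScaledTranslatingGroup»); hence `IsEmpty (PlanarSkeletonFrmScaled Cay)` (the U_s carrier), `IsEmpty
  (PlanarSkeletonFrm Cay)` (U), `IsEmpty (PlanarSkeletonNeg Cay)` (N1), `IsEmpty (PlanarSkeletonFrmFrom Cay)` (N2), and
  `IsEmpty (AutChart.OrbitDatum Cay A)` for EVERY acting group `A` (the orbit theorem's single-step datum, N3-a) — AT THE LEVEL OF `Aut(Cay)`, not only of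
  subgroups of `Γ₂` (the earlier records p588546/p592041).  The quasi-step datum of §27.3 (rung Q's input, needing hC) is untouched: it exists.
[cite: BartholdiErschler2012, §2–§3.1 (Γ₂ = ℤ ≀_X 𝔊, standard generating set)] [cite: Grigorchuk1980, every element of 𝔊 has finite order]
[cite: BenjaminiSchramm1996, Conj. 4; §2] [cite: KozmaNitzan2024, §4 p. 16 (Lemma 8)]
-/

noncomputable section

namespace Summit.CriticalPhenomena.PercolationContinuityZ3.Theorems.Transplant

namespace Grigorchuk

open SimpleGraph SemidirectProduct Literature.Probability.Percolation
open scoped Classical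

/-! ### §1 `Γ₂` is a one-lamp frame -/

/-- The lamp subgroup of `Γ₂`: trivial tree part. [cite: BartholdiErschler2012, §2 (Σ_X A ⊴ W)] -/
def lampsW : Subgroup ↥wreathZ := ((rightHom : LampGroup ℤ →* Equiv.Perm Ray).comp wreathZ.subtype).ker

/-- The tree subgroup of `Γ₂`: trivial lamp part (`≅ 𝔊`). [cite: BartholdiErschler2012, §2 (G ≤ W)] -/
def treesW : Subgroup ↥wreathZ := (inr : Equiv.Perm Ray →* LampGroup ℤ).range.comap wreathZ.subtype

/-- Membership in the lamp subgroup. [folklore] -/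
theorem mem_lampsW {x : ↥wreathZ} : x ∈ lampsW ↔ ((x : LampGroup ℤ)).right = 1 := by
  simp only [lampsW, MonoidHom.mem_ker, MonoidHom.coe_comp, Function.comp_apply, Subgroup.coe_subtype, rightHom_eq_right]

/-- Membership in the tree subgroup. [folklore] -/
theorem mem_treesW {x : ↥wreathZ} : x ∈ treesW ↔ ((x : LampGroup ℤ)).left = 1 := by
  simp only [treesW, Subgroup.mem_comap, Subgroup.coe_subtype, MonoidHom.mem_range]
  constructor
  · rintro ⟨g, hg⟩; rw [← hg, left_inr]
  · intro h; exact ⟨(x : LampGroup ℤ).right, SemidirectProduct.ext (by rw [left_inr, h]) (by rw [right_inr])⟩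

/-- The lamp part of an element of `Γ₂`, inside `Γ₂`. [cite: BartholdiErschler2012, §2] -/
def lamW (γ : ↥wreathZ) : ↥wreathZ := ⟨inl ((γ : LampGroup ℤ)).left, inl_left_mem_wreathZ γ.2⟩

/-- The tree part of an element of `Γ₂`, inside `Γ₂`. [cite: BartholdiErschler2012, §2] -/
def trW (γ : ↥wreathZ) : ↥wreathZ := ⟨inr ((γ : LampGroup ℤ)).right, inr_right_mem_wreathZ γ.2⟩

/-- A tree element is `inr` of its tree part. [folklore] -/
theorem coe_eq_inr_of_mem_treesW {h : ↥wreathZ} (hh : h ∈ treesW) : (h : LampGroup ℤ) = inr ((h : LampGroup ℤ)).right :=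
  SemidirectProduct.ext (by rw [left_inr, mem_treesW.1 hh]) (by rw [right_inr])

/-- The lamp part of a tree element is trivial. [folklore] -/
theorem lamW_eq_one_of_left {γ : ↥wreathZ} (h : ((γ : LampGroup ℤ)).left = 1) : lamW γ = 1 :=
  Subtype.ext (by simp only [lamW, h, map_one, Subgroup.coe_one])

/-- A lamp is its own lamp part. [folklore] -/
theorem lamW_eq_self_of_right {γ : ↥wreathZ} (h : ((γ : LampGroup ℤ)).right = 1) : lamW γ = γ :=
  Subtype.ext (SemidirectProduct.ext (by simp only [lamW, left_inl]) (by simp only [lamW, right_inl, h]))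

/-- **A position is the lamp at the image of `ρ`**: `h · s · h⁻¹ = lamp (h.right ρ) 1` for a tree element `h`. [cite: BartholdiErschler2012, §2] -/
theorem coe_conj_sW_of_mem_treesW {h : ↥wreathZ} (hh : h ∈ treesW) :
    ((h * sW * h⁻¹ : ↥wreathZ) : LampGroup ℤ) = lamp (((h : LampGroup ℤ)).right rho) 1 := by
  rw [Subgroup.coe_mul, Subgroup.coe_mul, Subgroup.coe_inv, coe_eq_inr_of_mem_treesW hh, coe_sW]
  exact tree_mul_lamp_mul_tree_inv _ _ _

/-- Integer powers of a lamp letter. [folklore] -/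
theorem lamp_zpow (x : Ray) (m : ℤ) : (lamp x 1 : LampGroup ℤ) ^ m = lamp x m := by
  rw [lamp, lamp, ← map_zpow, ← ofAdd_zsmul, Finsupp.smul_single, smul_eq_mul, mul_one]

/-- The positions of `Γ₂` generate a subgroup normalised by the tree subgroup. [folklore] -/
theorem conj_mem_closure_positions {t : ↥wreathZ} (ht : t ∈ treesW) {c : ↥wreathZ}
    (hc : c ∈ Subgroup.closure {y : ↥wreathZ | ∃ h ∈ treesW, y = h * sW * h⁻¹}) :
    t * c * t⁻¹ ∈ Subgroup.closure {y : ↥wreathZ | ∃ h ∈ treesW, y = h * sW * h⁻¹} := by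
  refine Subgroup.closure_induction (p := fun c _ => t * c * t⁻¹ ∈ Subgroup.closure {y : ↥wreathZ | ∃ h ∈ treesW, y = h * sW * h⁻¹}) ?_ ?_ ?_ ?_ hc
  · rintro _ ⟨h, hh, rfl⟩
    exact Subgroup.subset_closure ⟨t * h, treesW.mul_mem ht hh, by group⟩
  · rw [mul_one, mul_inv_cancel]; exact Subgroup.one_mem _
  · intro x y _ _ hx hy
    have e : t * (x * y) * t⁻¹ = (t * x * t⁻¹) * (t * y * t⁻¹) := by group
    rw [e]; exact Subgroup.mul_mem _ hx hy
  · intro x _ hx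
    have e : t * x⁻¹ * t⁻¹ = (t * x * t⁻¹)⁻¹ := by group
    rw [e]; exact Subgroup.inv_mem _ hx

/-- **The one-lamp frame structure of `Γ₂ = ℤ ≀_X 𝔊`** (tree part torsion by Grigorchuk's theorem p591617; positions independent as `Finsupp.single`s;
lamps generated by positions). [cite: BartholdiErschler2012, §2–§3.1] [cite: Grigorchuk1980, every element of 𝔊 has finite order] -/
def frameW : OneLampFrame ↥wreathZ where
  L := lampsW
  H := treesW
  normal := MonoidHom.normal_ker _
  comm := by
    intro x hx y hy
    rw [mem_lampsW] at hx hy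
    refine Subtype.ext (SemidirectProduct.ext ?_ ?_)
    · simp only [Subgroup.coe_mul, mul_left, hx, hy, map_one, MulAut.one_apply]
      exact mul_comm _ _
    · simp only [Subgroup.coe_mul, mul_right, hx, hy]
  torsion := by
    intro t ht
    obtain ⟨g, hg⟩ := (Subgroup.mem_comap.1 ht : ((t : ↥wreathZ) : LampGroup ℤ) ∈ (inr : Equiv.Perm Ray →* LampGroup ℤ).range)
    have hg' : (inr g : LampGroup ℤ) = (t : LampGroup ℤ) := hg
    have hgG : g ∈ grigorchukGroup := by
      have := right_mem_grigorchukGroup t.2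
      rwa [← hg', right_inr] at this
    obtain ⟨n, hn, hgn⟩ := (isOfFinOrder_of_mem hgG).exists_pow_eq_one
    refine isOfFinOrder_iff_pow_eq_one.2 ⟨n, hn, Subtype.ext ?_⟩
    rw [Subgroup.coe_pow, ← hg', ← map_pow, hgn, map_one, Subgroup.coe_one]
  disjoint := by
    intro x hx hx'
    rw [mem_lampsW] at hx
    rw [mem_treesW] at hx'
    exact Subtype.ext (SemidirectProduct.ext (by rw [hx', Subgroup.coe_one, one_left]) (by rw [hx, Subgroup.coe_one, one_right]))
  lam := lamW
  tr := trW
  lam_mem := fun γ => mem_lampsW.2 (by simp [lamW])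
  tr_mem := fun γ => mem_treesW.2 (by simp [trW])
  lam_mul_tr := fun γ => Subtype.ext (by simp [lamW, trW, inl_left_mul_inr_right])
  s := sW
  s_mem := mem_lampsW.2 rfl
  s_zpow := by
    intro n hn
    have h := congrArg (fun π : ↥wreathZ => Multiplicative.toAdd (lampSum ℤ (π : LampGroup ℤ))) hn
    simp only [Subgroup.coe_zpow, map_zpow, coe_sW, lampSum_lamp, Subgroup.coe_one, map_one, toAdd_one, toAdd_zpow, toAdd_ofAdd,
      smul_eq_mul, mul_one] at h
    exact h
  free := by
    intro h₁ hh₁ h₂ hh₂ hne m n he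
    have e := congrArg (fun π : ↥wreathZ => Multiplicative.toAdd ((π : LampGroup ℤ)).left) he
    simp only [Subgroup.coe_zpow, coe_conj_sW_of_mem_treesW hh₁, coe_conj_sW_of_mem_treesW hh₂, lamp_zpow, lamp_left, toAdd_ofAdd] at e
    rcases (Finsupp.single_eq_single_iff _ _ _ _).1 e with ⟨hxy, -⟩ | hmn
    · exfalso; apply hne
      exact Subtype.ext (by rw [coe_conj_sW_of_mem_treesW hh₁, coe_conj_sW_of_mem_treesW hh₂, hxy])
    · exact hmn
  gen := by
    -- every element of `Γ₂` has its lamp part in the closure `C` of the positions; lamps are their own lamp parts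
    intro x hx
    set C : Subgroup ↥wreathZ := Subgroup.closure {y : ↥wreathZ | ∃ h ∈ treesW, y = h * sW * h⁻¹} with hC
    suffices key : ∀ γ : ↥wreathZ, lamW γ ∈ C by
      have e : lamW x = x := Subtype.ext (by
        change (inl ((x : LampGroup ℤ)).left : LampGroup ℤ) = x
        exact SemidirectProduct.ext (by rw [left_inl]) (by rw [right_inl, mem_lampsW.1 hx]))
      rw [← e]; exact key x
    rintro ⟨g, hg⟩
    induction hg using Subgroup.closure_induction with
    | mem y hy =>
      simp only [Set.mem_insert_iff, Set.mem_singleton_iff] at hy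
      rcases hy with rfl | rfl | rfl | rfl | rfl
      · rw [lamW_eq_one_of_left (by exact tree_left _)]; exact C.one_mem
      · rw [lamW_eq_one_of_left (by exact tree_left _)]; exact C.one_mem
      · rw [lamW_eq_one_of_left (by exact tree_left _)]; exact C.one_mem
      · rw [lamW_eq_one_of_left (by exact tree_left _)]; exact C.one_mem
      · rw [lamW_eq_self_of_right (by exact lamp_right _ _)]
        refine Subgroup.subset_closure ⟨1, treesW.one_mem, ?_⟩
        rw [one_mul, inv_one, mul_one]; rfl
    | one => rw [lamW_eq_one_of_left (by exact one_left)]; exact C.one_mem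
    | mul y z hy hz ihy ihz =>
      -- `lam (y z) = lam y · (tr y · lam z · (tr y)⁻¹)`
      have ht : trW ⟨y, hy⟩ ∈ treesW := mem_treesW.2 (by simp [trW])
      have e : lamW ⟨y * z, wreathZ.mul_mem hy hz⟩ = lamW ⟨y, hy⟩ * (trW ⟨y, hy⟩ * lamW ⟨z, hz⟩ * (trW ⟨y, hy⟩)⁻¹) :=
        Subtype.ext (by
          simp only [lamW, trW, Subgroup.coe_mul, Subgroup.coe_inv, mul_left, map_mul]
          rw [SemidirectProduct.inl_aut, map_inv])
      rw [e]
      exact C.mul_mem ihy (conj_mem_closure_positions ht ihz)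
    | inv y hy ihy =>
      -- `lam (y⁻¹) = (tr y)⁻¹ · (lam y)⁻¹ · tr y`
      have ht : (trW ⟨y, hy⟩)⁻¹ ∈ treesW := treesW.inv_mem (mem_treesW.2 (by simp [trW]))
      have e : lamW ⟨y⁻¹, wreathZ.inv_mem hy⟩ = (trW ⟨y, hy⟩)⁻¹ * (lamW ⟨y, hy⟩)⁻¹ * (trW ⟨y, hy⟩)⁻¹⁻¹ :=
        Subtype.ext (by
          simp only [lamW, trW, Subgroup.coe_mul, Subgroup.coe_inv, inv_inv]
          rw [inv_left, SemidirectProduct.inl_aut, map_inv, map_inv, inv_inv])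
      rw [e]
      exact conj_mem_closure_positions ht (C.inv_mem ihy)

/-- The tree subgroup of the frame is `treesW`, its lamp letter is `sW`. [folklore] -/
theorem frameW_H : frameW.H = treesW ∧ frameW.s = sW := ⟨rfl, rfl⟩

/-! ### §2 Every group of automorphisms acts by label-preserving maps -/

/-- **An automorphism commutes with right multiplication by the whole tree subgroup** (closure induction from the letters `a, b, c, d`). [folklore] -/
theorem cay_aut_mul_of_mem_treesW (φ : Cay ≃g Cay) (γ : ↥wreathZ) {t : ↥wreathZ} (ht : t ∈ treesW) : φ (γ * t) = φ γ * t := by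
  have hcoe := coe_eq_inr_of_mem_treesW ht
  have hg : ((t : LampGroup ℤ)).right ∈ grigorchukGroup := right_mem_grigorchukGroup t.2
  -- induction over `𝔊 = ⟨a, b, c, d⟩` for the statement with an arbitrary `γ`
  have key : ∀ g ∈ grigorchukGroup, ∀ (hg' : (tree g : LampGroup ℤ) ∈ wreathZ) (δ : ↥wreathZ), φ (δ * ⟨tree g, hg'⟩) = φ δ * ⟨tree g, hg'⟩ := by
    intro g hg
    induction hg using Subgroup.closure_induction with
    | mem y hy =>
      intro hy' δ
      simp only [Set.mem_insert_iff, Set.mem_singleton_iff] at hy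
      obtain ⟨ha, hb, hc, hd, -⟩ := cay_label_rigid φ δ
      rcases hy with rfl | rfl | rfl | rfl
      · exact ha
      · exact hb
      · exact hc
      · exact hd
    | one => intro hy' δ; have : (⟨tree 1, hy'⟩ : ↥wreathZ) = 1 := Subtype.ext (by simp [tree]); rw [this, mul_one, mul_one]
    | mul y z hy hz ihy ihz =>
      intro hy' δ
      have e : (⟨tree (y * z), hy'⟩ : ↥wreathZ) = ⟨tree y, tree_mem_wreathZ hy⟩ * ⟨tree z, tree_mem_wreathZ hz⟩ :=
        Subtype.ext (by simp [tree])
      rw [e, ← mul_assoc, ← mul_assoc, ihz, ihy]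
    | inv y hy ihy =>
      intro hy' δ
      have e : (⟨tree y⁻¹, hy'⟩ : ↥wreathZ) = (⟨tree y, tree_mem_wreathZ hy⟩)⁻¹ := Subtype.ext (by simp [tree])
      rw [e]
      have h := ihy (tree_mem_wreathZ hy) (δ * (⟨tree y, tree_mem_wreathZ hy⟩)⁻¹)
      rw [inv_mul_cancel_right] at h
      rw [eq_mul_inv_iff_mul_eq, h]
  have e : t = ⟨tree ((t : LampGroup ℤ)).right, hcoe ▸ t.2⟩ := Subtype.ext hcoe
  rw [e]
  exact key _ hg _ γ

/-- **EVERY group acting on `Γ₂` by automorphisms of `Cay(ℤ ≀_X 𝔊; a,b,c,d,s)` is a label-preserving action** of the one-lamp frame `frameW`.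
[cite: BartholdiErschler2012, §2–§3.1] -/
theorem labelAction_of_isActionByAut {A : Type} [Group A] [MulAction A ↥wreathZ] (hact : IsActionByAut Cay A) : frameW.LabelAction A := by
  -- each `a` acts as the automorphism `toAut a`
  have toAut : ∀ a : A, ∃ φ : Cay ≃g Cay, ∀ v, φ v = a • v := fun a =>
    ⟨{ toEquiv := MulAction.toPerm a, map_rel_iff' := hact a _ _ }, fun _ => rfl⟩
  refine ⟨fun a γ h hh => ?_, fun a γ => ?_⟩
  · obtain ⟨φ, hφ⟩ := toAut a
    rw [← hφ, ← hφ]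
    exact cay_aut_mul_of_mem_treesW φ γ hh
  · obtain ⟨φ, hφ⟩ := toAut a
    rw [← hφ, ← hφ]
    exact (cay_label_rigid φ γ).2.2.2.2

/-! ### §3 No single-step input on Bartholdi–Erschler's Cayley graph, for any group of automorphisms -/

/-- A neighbour is `γ·x` for an `x` in the tree subgroup or `x = s^{±1}`. [folklore] -/
theorem exists_letter_of_cay_adj {γ v : ↥wreathZ} (h : Cay.Adj γ v) : ∃ x : ↥wreathZ, (x ∈ frameW.H ∨ x = frameW.s ∨ x = frameW.s⁻¹) ∧ v = γ * x := by
  obtain ⟨y, rfl⟩ := cay_adj_iff.1 h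
  refine ⟨y.toW, ?_, rfl⟩
  rw [frameW_H.1, frameW_H.2]
  cases y
  · exact Or.inl (mem_treesW.2 rfl)
  · exact Or.inl (mem_treesW.2 rfl)
  · exact Or.inl (mem_treesW.2 rfl)
  · exact Or.inl (mem_treesW.2 rfl)
  · exact Or.inr (Or.inl rfl)
  · exact Or.inr (Or.inr rfl)

/-- **NO EQUIVARIANT CHART WITH EXACT SINGLE-EDGE STEPS, for any group of automorphisms with finitely many orbits.**  For every group `A` acting on
`Γ₂` by automorphisms of `Cay` with finitely many orbits (`A·R = Γ₂`, `R` finite), every `φ : Γ₂ → ℤ²` with `φ(a·γ) = φ γ + c a` and every `N ≥ 1`, the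
steps `± N eᵢ` along single edges FAIL at some vertex.  (The orbit theorem (N3-a) and the one-type nodes have no input on B–E's Cayley graph from ANY
`A ≤ Aut` — caveat (α) of `P3-NILPOTENT` §26–§28 discharged; `θ(p_c) = 0` here stays NOT PROVED.) [cite: BenjaminiSchramm1996, Conj. 4; §2] -/
theorem cay_no_single_edge_steps {A : Type} [Group A] [MulAction A ↥wreathZ] (hact : IsActionByAut Cay A) (R : Finset ↥wreathZ)
    (hRc : ∀ γ : ↥wreathZ, ∃ a : A, ∃ r ∈ R, a • r = γ) (φ : ↥wreathZ → Fin 2 → ℤ) (c : A → Fin 2 → ℤ)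
    (hφ : ∀ (a : A) (γ : ↥wreathZ), φ (a • γ) = φ γ + c a) (N : ℕ) (hN : 1 ≤ N) :
    ¬ ∀ (v : ↥wreathZ) (i : Fin 2) (σ : ℤˣ), ∃ v' : ↥wreathZ, Cay.Adj v v' ∧ φ v' = φ v + Pi.single i ((N : ℤ) * σ) := by
  intro hstep
  refine (labelAction_of_isActionByAut hact).no_single_edge_steps R hRc φ c hφ N hN fun γ i σ => ?_
  obtain ⟨v', hadj, hv'⟩ := hstep γ i σ
  obtain ⟨x, hx, rfl⟩ := exists_letter_of_cay_adj hadj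
  exact ⟨x, hx, hv'⟩

/-- **NO FRAMED CHART WITH EXACT SINGLE-EDGE STEPS.**  For every `φ : Γ₂ → ℤ²` with FRAMES (every vertex is the image of one of finitely many base vertices
under an automorphism translating `φ`) and every `N ≥ 1`, the steps `± N eᵢ` along single edges fail at some vertex. [cite: BenjaminiSchramm1996, Conj. 4; §2] -/
theorem cay_no_framed_steps (φ : ↥wreathZ → Fin 2 → ℤ) (types : Finset ↥wreathZ)
    (hframe : ∀ v : ↥wreathZ, ∃ t ∈ types, ∃ α : Cay ≃g Cay, α t = v ∧ ∀ w, φ (α w) = φ w + (φ v - φ t)) (N : ℕ) (hN : 1 ≤ N) :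
    ¬ ∀ (v : ↥wreathZ) (i : Fin 2) (σ : ℤˣ), ∃ v' : ↥wreathZ, Cay.Adj v v' ∧ φ v' = φ v + Pi.single i ((N : ℤ) * σ) := by
  letI : MulAction (Cay ≃g Cay) ↥wreathZ := AutChart.autMulAction Cay
  obtain ⟨A, hA⟩ := FrmScaledAut.exists_translatingSubgroup (G := Cay) φ
  have hact : IsActionByAut Cay ↥A := fun a x y => (a : Cay ≃g Cay).map_adj_iff
  -- the translation character and the cover by the base vertices
  refine cay_no_single_edge_steps hact types (fun γ => ?_) φ (fun a => φ ((a : Cay ≃g Cay) 1) - φ 1) (fun a γ => ?_) N hN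
  · obtain ⟨t, ht, α, hαt, hαw⟩ := hframe γ
    exact ⟨⟨α, (hA α).2 ⟨_, hαw⟩⟩, t, ht, hαt⟩
  · obtain ⟨d, hd⟩ := (hA a).1 a.2
    show φ ((a : Cay ≃g Cay) γ) = _
    rw [hd γ, hd 1, add_sub_cancel_left]

/-- **`Cay(ℤ ≀_X 𝔊; a,b,c,d,s)` carries NO `PlanarSkeletonFrmScaled`** (the carrier of the one-orbit scaled node U_s). [cite: BenjaminiSchramm1996, Conj. 4; §2] -/
theorem isEmpty_planarSkeletonFrmScaled [Cay.LocallyFinite] : IsEmpty (PlanarSkeletonFrmScaled Cay) :=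
  ⟨fun Φ => cay_no_framed_steps Φ.φ Φ.types Φ.frame Φ.N Φ.one_le_N Φ.step⟩

/-- **… NO `PlanarSkeletonFrm`** (the carrier of node U). [cite: BenjaminiSchramm1996, Conj. 4; §2] -/
theorem isEmpty_planarSkeletonFrm [Cay.LocallyFinite] : IsEmpty (PlanarSkeletonFrm Cay) :=
  ⟨fun Φ => cay_no_framed_steps Φ.φ Φ.types Φ.frame 1 le_rfl fun v i σ => by simpa only [Nat.cast_one, one_mul] using Φ.step v i σ⟩

/-- **… NO `PlanarSkeletonNeg`** (the carrier of node N1). [cite: BenjaminiSchramm1996, Conj. 4; §2] -/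
theorem isEmpty_planarSkeletonNeg [Cay.LocallyFinite] : IsEmpty (PlanarSkeletonNeg Cay) :=
  ⟨fun Φ => cay_no_framed_steps Φ.φ Φ.types Φ.frame 1 le_rfl fun v i σ => by simpa only [Nat.cast_one, one_mul] using Φ.step v i σ⟩

/-- **… NO `PlanarSkeletonFrmFrom`** (the carrier of node N2). [cite: BenjaminiSchramm1996, Conj. 4; §2] -/
theorem isEmpty_planarSkeletonFrmFrom [Cay.LocallyFinite] : IsEmpty (PlanarSkeletonFrmFrom Cay) :=
  ⟨fun Φ => cay_no_framed_steps Φ.φ Φ.types Φ.frame 1 le_rfl fun v i σ => by simpa only [Nat.cast_one, one_mul] using Φ.step v i σ⟩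

/-- **… and NO single-step ORBIT DATUM for ANY acting group** (the input of the orbit theorem (N3-a), «AutChartOrbitsDatum»).
[cite: BenjaminiSchramm1996, Conj. 4; §2] [cite: KozmaNitzan2024, §4 p. 16 (Lemma 8)] -/
theorem isEmpty_orbitDatum {A : Type} [Group A] [MulAction A ↥wreathZ] : IsEmpty (AutChart.OrbitDatum Cay A) :=
  ⟨fun D => cay_no_single_edge_steps D.act D.reps D.cover D.chart D.ψ (fun a γ => by rw [D.chart_smul, add_comm]) D.N D.one_le_N D.step_at⟩

end Grigorchuk

end Summit.CriticalPhenomena.PercolationContinuityZ3.Theorems.Transplant
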